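import Summits.HodgeConjecture.HodgeConjecture.Theorems.F0P3cStCharTSAdRegularisedDet   -- ★ p851816 (LH6-p02 (g6)) C7 file 1: the `Ad_t − 1` vocabulary `LinearMap.mulLeftRight K (↑t, ↑t⁻¹) - LinearMap.id`
import Literature.LinearAlgebra.Matrix.RegularAdRangeSupCommutant   -- ★ `isCompl_ker_range_mulLeft_sub_mulRight_of_separable_charpoly` (`M_n(K) = ker ad_A ⊕ range ad_A`, semisimplicity of `L_A − R_A`)
import Mathlib.LinearAlgebra.Projection
import Mathlib.LinearAlgebra.Determinant
import HarnessLib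

/-!
# F0 · P3c · line LH6 «StCharTS» — ROAD «JAC-ELL» brick (Q8) «CARTAN DECOMPOSITION OF `𝔲(J)` AT A REGULAR ELEMENT»: `M_n(K) = 𝔷(t) ⊕ (Ad_t − 1)M_n(K)` for `t` regular
# semisimple, its descent to the `F`-Lie algebra `𝔲 = {X | (X.map σ)ᵀ J + J X = 0}` of a unitary group at a unitary `t₀`, and the linear part `L̃ = (Ad t₀⁻¹ − 1) ∘ pr_𝔪 + pr_𝔱`

Cell `pub/hodgecm-mathlib`, crux H413 = `stmt-HodgeConjecture-24833` (lane `--supports … --as helper`), route HCCMUnconditional; seat F0P3-p04 (g18), brick (Q8) of LH5-p02 (g6)'s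
road «JAC-ELL» (memo `F0/P3c/LH5/LH5-p02/g6/ROAD-JAC-ELL.v1.LH5p02g6.md` §1 row Q8, dealt 2026-09-02T15:20Z), in LH6-p02 (g6)'s C7 vocabulary (★ `F0P3cStCharTSAdRegularisedDet`:
`Ad_t − 1 = LinearMap.mulLeftRight K (↑t, ↑t⁻¹) - LinearMap.id`, regularised operators `Φ` with (h1) `Φ ∘ (Ad_t − 1) = (Ad_{t⁻¹} − 1) ∘ (Ad_t − 1)`, (h2) `Φ Z = Z` on `𝔷(t)`).
THEOREMS ONLY (no definition ∕ instance ∕ notation ∕ named fact ∕ `sorry`); Mathlib + ★ C7.  The `F`-Lie algebra `𝔲` is a BINDER given by its FIELD HYPOTHESIS (road rule §2.1).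
HONEST LABEL: HC_CM is proved only modulo the 7 printed citations (2 remaining: hLiu418 = `stmt-HodgeConjecture-24832`, h413 = `stmt-HodgeConjecture-24833`) until rung 0 closes;
count-neutral linear algebra for the ELLIPTIC half of the print residue «WIF» of (S-𝔇); closes no organ.

THE MATHEMATICS ([HarishChandra1970, Lemma 22: the Jacobian `det((1 − Ad t)|_{𝔤∕𝔱})` of `(x, t) ↦ x t x⁻¹`]; [Rogawski1990, §12.5 p. 182]).  `t ∈ GL_n(K)` with SEPARABLE characteristic
polynomial, `K` perfect.  `Ad_t − 1 = R_{t⁻¹} ∘ δ_t` with `δ_t := L_t − R_t` (`L`, `R` = left ∕ right multiplication), `R_{t⁻¹}` an automorphism commuting with `δ_t`; `L_t`, `R_t` commute and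
are killed by the separable `χ_t` (Cayley–Hamilton), hence are semisimple, hence so is `δ_t` (Mathlib `IsSemisimple.sub_of_commute`, perfect field); a semisimple endomorphism `f` of
a finite-dimensional space has `ker f ⊕ range f = ⊤` (§1: an `f`-stable complement `q` of `ker f` has `f|_q` injective, so `range f = q`).  Hence **`M_n(K) = 𝔷(t) ⊕ 𝔪_K`**,
`𝔷(t) = ker(Ad_t − 1) = {Z | Zt = tZ}`, `𝔪_K = (Ad_t − 1)M_n(K)`, and `Ad_{t⁻¹} − 1 = −Ad_{t⁻¹} ∘ (Ad_t − 1)` is BIJECTIVE on `𝔪_K` (§2).  DESCENT (§3): for `σ : K →+* K` fixing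
`F ⊆ K`, `J` invertible and `t₀` unitary (`(↑t₀.map σ)ᵀ J ↑t₀ = J`), the σ-semilinear map `τ(X) := J⁻¹ (X.map σ)ᵀ J` satisfies `τ ∘ Ad_{t₀} = Ad_{t₀} ∘ τ`, so it preserves
`𝔷(t₀)` and `𝔪_K`; `X ∈ 𝔲 ⟺ τ X = −X`, and splitting `X = k + r` gives `−X = τk + τr`, so `k = −τk ∈ 𝔲`, `r = −τr ∈ 𝔲` by uniqueness: **`𝔲 = 𝔱 ⊕ 𝔪`** with `𝔱 = 𝔲 ∩ 𝔷(t₀)`,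
`𝔪 = 𝔲 ∩ 𝔪_K` as `F`-submodules of `↥𝔲`; both are `Ad_s`-stable for every unitary `s ∈ Z(t₀)`.  LINEAR PART (§4): `L̃ := pr_𝔱 + (Ad_{t₀⁻¹} − 1) ∘ pr_𝔪` is an `F`-linear
automorphism of `𝔲` (injective: `a + (Ad_{t₀⁻¹} − 1)b = 0` forces `a ∈ 𝔱 ∩ 𝔪 = 0` and then `b = 0` by §2; surjective by finite dimension), and its `K`-linear COMPANION
`Φ := pr_𝔷 + (Ad_{t₀⁻¹} − 1) ∘ pr_{𝔪_K}` on `M_n(K)` extends `L̃` and is a regularised Jacobian operator in the sense of ★ C7 ((h1) `Φ ∘ (Ad_{t₀} − 1) = (Ad_{t₀⁻¹} − 1) ∘ (Ad_{t₀} − 1)`,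
(h2) `Φ = id` on `𝔷(t₀)`), so that ★ C7 gives `det_K Φ = −disc(χ_{t₀})∕det(t₀)²` and C7 file 3 reads `det_F L̃` against it (`𝔲 ⊗_F K = M_n(K)`) — delivered as an ∃-bundle (no definition).
THIS FILE (1 ∕ 2, the `K`-level; the semisimplicity step is ★ `Literature.LinearAlgebra.Matrix.RegularAdRangeSupCommutant`, imported): §2 `adSubOne_eq_mulRight_comp`,
`ker_adSubOne_eq`, `range_adSubOne_eq`, **`isCompl_ker_range_adSubOne`**, `mem_ker_adSubOne_iff`, `adInvSubOne_eq_neg_comp`, `adInv_comp_adSubOne_comm`, `adInvSubOne_mem_range`,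
`eq_zero_of_adInvSubOne_eq_zero`.  FILE 2 ∕ 2 `F0P3cStCharTSCartanDecompositionSkew`: the `F`-descent (§3) and the linear part `L̃` with its `K`-companion `Φ` (§4).

## References
* [HarishChandra1970] Harish-Chandra, *Harmonic analysis on reductive p-adic groups*, LNM 162 (1970), Lemma 22.
* [Rogawski1990] J. D. Rogawski, *Automorphic Representations of Unitary Groups in Three Variables*, Ann. of Math. Stud. 123 (1990), §12.5 p. 182; §4.9 p. 54.
-/

set_option autoImplicit false
-- the mandated namespace has the single-problem summit's repeated segment (`HodgeConjecture.HodgeConjecture`)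
set_option linter.dupNamespace false

noncomputable section

open Polynomial Module
open scoped Matrix

namespace Summit.HodgeConjecture.HodgeConjecture.Cruxes.H413.F0P3cStCharTSCartanDecompositionAd

/-! ## §2 `M_n(K) = 𝔷(t) ⊕ (Ad_t − 1)M_n(K)` for `χ_t` separable; `Ad_{t⁻¹} − 1` on the moving part -/

section AdK

variable {K : Type*} [Field K] {n : Type*} [Fintype n] [DecidableEq n]

/-- `Ad_t − 1 = R_{t⁻¹} ∘ (L_t − R_t)`: `tXt⁻¹ − X = (tX − Xt)t⁻¹`. [cite: HarishChandra1970, Lemma 22] -/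
theorem adSubOne_eq_mulRight_comp (t : GL n K) :
    (LinearMap.mulLeftRight K ((t : Matrix n n K), ((t⁻¹ : GL n K) : Matrix n n K)) - LinearMap.id : Matrix n n K →ₗ[K] Matrix n n K) =
      LinearMap.mulRight K ((t⁻¹ : GL n K) : Matrix n n K) ∘ₗ (LinearMap.mulLeft K (t : Matrix n n K) - LinearMap.mulRight K (t : Matrix n n K)) := by
  ext X
  simp only [LinearMap.sub_apply, LinearMap.mulLeftRight_apply, LinearMap.id_apply, LinearMap.comp_apply, LinearMap.mulRight_apply,
    LinearMap.mulLeft_apply, sub_mul, Matrix.mul_assoc, Units.mul_inv, Matrix.mul_one]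

/-- `ker (Ad_t − 1) = ker (L_t − R_t)` (`R_{t⁻¹}` is injective). [cite: HarishChandra1970, Lemma 22] -/
theorem ker_adSubOne_eq (t : GL n K) :
    LinearMap.ker (LinearMap.mulLeftRight K ((t : Matrix n n K), ((t⁻¹ : GL n K) : Matrix n n K)) - LinearMap.id : Matrix n n K →ₗ[K] Matrix n n K) =
      LinearMap.ker (LinearMap.mulLeft K (t : Matrix n n K) - LinearMap.mulRight K (t : Matrix n n K)) := by
  rw [adSubOne_eq_mulRight_comp]
  apply LinearMap.ker_comp_of_ker_eq_bot
  rw [LinearMap.ker_eq_bot']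
  intro X hX
  have h := congrArg (fun Y => Y * (t : Matrix n n K)) hX
  simpa only [LinearMap.mulRight_apply, Matrix.mul_assoc, Units.inv_mul, Matrix.mul_one, Matrix.zero_mul] using h

/-- `range (Ad_t − 1) = range (L_t − R_t)` (`R_{t⁻¹}` is a bijection commuting with `L_t − R_t`). [cite: HarishChandra1970, Lemma 22] -/
theorem range_adSubOne_eq (t : GL n K) :
    LinearMap.range (LinearMap.mulLeftRight K ((t : Matrix n n K), ((t⁻¹ : GL n K) : Matrix n n K)) - LinearMap.id : Matrix n n K →ₗ[K] Matrix n n K) =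
      LinearMap.range (LinearMap.mulLeft K (t : Matrix n n K) - LinearMap.mulRight K (t : Matrix n n K)) := by
  have hcomm : LinearMap.mulRight K ((t⁻¹ : GL n K) : Matrix n n K) ∘ₗ (LinearMap.mulLeft K (t : Matrix n n K) - LinearMap.mulRight K (t : Matrix n n K)) =
      (LinearMap.mulLeft K (t : Matrix n n K) - LinearMap.mulRight K (t : Matrix n n K)) ∘ₗ LinearMap.mulRight K ((t⁻¹ : GL n K) : Matrix n n K) := by
    ext X
    simp only [LinearMap.comp_apply, LinearMap.sub_apply, LinearMap.mulRight_apply, LinearMap.mulLeft_apply, sub_mul, Matrix.mul_assoc,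
      Units.inv_mul, Units.mul_inv]
  have hsurj : LinearMap.range (LinearMap.mulRight K ((t⁻¹ : GL n K) : Matrix n n K) : Matrix n n K →ₗ[K] Matrix n n K) = ⊤ := by
    rw [LinearMap.range_eq_top]
    intro Y
    exact ⟨Y * (t : Matrix n n K), by simp only [LinearMap.mulRight_apply, Matrix.mul_assoc, Units.mul_inv, Matrix.mul_one]⟩
  rw [adSubOne_eq_mulRight_comp, hcomm, LinearMap.range_comp, hsurj, Submodule.map_top]

/-- **`M_n(K) = 𝔷(t) ⊕ (Ad_t − 1)M_n(K)`** for `t ∈ GL_n(K)` with separable characteristic polynomial (`K` perfect).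
[cite: HarishChandra1970, Lemma 22] [cite: Rogawski1990, §12.5 p. 182] -/
theorem isCompl_ker_range_adSubOne [PerfectField K] (t : GL n K) (hsep : (t : Matrix n n K).charpoly.Separable) :
    IsCompl (LinearMap.ker (LinearMap.mulLeftRight K ((t : Matrix n n K), ((t⁻¹ : GL n K) : Matrix n n K)) - LinearMap.id : Matrix n n K →ₗ[K] Matrix n n K))
      (LinearMap.range (LinearMap.mulLeftRight K ((t : Matrix n n K), ((t⁻¹ : GL n K) : Matrix n n K)) - LinearMap.id : Matrix n n K →ₗ[K] Matrix n n K)) := by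
  rw [ker_adSubOne_eq, range_adSubOne_eq]
  exact Literature.LinearAlgebra.Matrix.isCompl_ker_range_mulLeft_sub_mulRight_of_separable_charpoly (t : Matrix n n K) hsep

/-- `X ∈ 𝔷(t) = ker (Ad_t − 1) ↔ X t = t X`. [cite: HarishChandra1970, Lemma 22] -/
theorem mem_ker_adSubOne_iff (t : GL n K) (X : Matrix n n K) :
    X ∈ LinearMap.ker (LinearMap.mulLeftRight K ((t : Matrix n n K), ((t⁻¹ : GL n K) : Matrix n n K)) - LinearMap.id : Matrix n n K →ₗ[K] Matrix n n K) ↔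
      X * (t : Matrix n n K) = (t : Matrix n n K) * X := by
  rw [ker_adSubOne_eq, LinearMap.mem_ker, LinearMap.sub_apply, LinearMap.mulLeft_apply, LinearMap.mulRight_apply, sub_eq_zero, eq_comm]

/-- `Ad_{t⁻¹} − 1 = −Ad_{t⁻¹} ∘ (Ad_t − 1)`. [cite: HarishChandra1970, Lemma 22] -/
theorem adInvSubOne_eq_neg_comp (t : GL n K) :
    (LinearMap.mulLeftRight K (((t⁻¹ : GL n K) : Matrix n n K), (t : Matrix n n K)) - LinearMap.id : Matrix n n K →ₗ[K] Matrix n n K) =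
      -(LinearMap.mulLeftRight K (((t⁻¹ : GL n K) : Matrix n n K), (t : Matrix n n K)) ∘ₗ
          (LinearMap.mulLeftRight K ((t : Matrix n n K), ((t⁻¹ : GL n K) : Matrix n n K)) - LinearMap.id)) := by
  ext X
  simp only [LinearMap.sub_apply, LinearMap.mulLeftRight_apply, LinearMap.id_apply, LinearMap.neg_apply, LinearMap.comp_apply, Matrix.mul_sub,
    Matrix.sub_mul, Matrix.mul_assoc, Units.inv_mul, Matrix.mul_one, ← Matrix.mul_assoc ((t⁻¹ : GL n K) : Matrix n n K) (t : Matrix n n K),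
    Matrix.one_mul, neg_sub]

/-- `Ad_{t⁻¹}` commutes with `Ad_t − 1`. [cite: HarishChandra1970, Lemma 22] -/
theorem adInv_comp_adSubOne_comm (t : GL n K) :
    LinearMap.mulLeftRight K (((t⁻¹ : GL n K) : Matrix n n K), (t : Matrix n n K)) ∘ₗ
        (LinearMap.mulLeftRight K ((t : Matrix n n K), ((t⁻¹ : GL n K) : Matrix n n K)) - LinearMap.id : Matrix n n K →ₗ[K] Matrix n n K) =
      (LinearMap.mulLeftRight K ((t : Matrix n n K), ((t⁻¹ : GL n K) : Matrix n n K)) - LinearMap.id) ∘ₗ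
        LinearMap.mulLeftRight K (((t⁻¹ : GL n K) : Matrix n n K), (t : Matrix n n K)) := by
  ext X
  simp only [LinearMap.comp_apply, LinearMap.sub_apply, LinearMap.mulLeftRight_apply, LinearMap.id_apply, Matrix.mul_sub, Matrix.sub_mul,
    Matrix.mul_assoc, Units.inv_mul, Units.mul_inv, Matrix.mul_one, ← Matrix.mul_assoc ((t⁻¹ : GL n K) : Matrix n n K) (t : Matrix n n K),
    ← Matrix.mul_assoc (t : Matrix n n K) ((t⁻¹ : GL n K) : Matrix n n K), Matrix.one_mul]

/-- `Ad_{t⁻¹} − 1 = −Ad_{t⁻¹} ∘ (Ad_t − 1) = −(Ad_t − 1) ∘ Ad_{t⁻¹}` takes values in the moving part `𝔪_K = (Ad_t − 1)M_n(K)` (in particular it maps `𝔪_K` into itself).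
[cite: HarishChandra1970, Lemma 22] -/
theorem adInvSubOne_mem_range (t : GL n K) (Y : Matrix n n K) :
    (LinearMap.mulLeftRight K (((t⁻¹ : GL n K) : Matrix n n K), (t : Matrix n n K)) - LinearMap.id : Matrix n n K →ₗ[K] Matrix n n K) Y ∈
      LinearMap.range (LinearMap.mulLeftRight K ((t : Matrix n n K), ((t⁻¹ : GL n K) : Matrix n n K)) - LinearMap.id : Matrix n n K →ₗ[K] Matrix n n K) := by
  rw [adInvSubOne_eq_neg_comp, LinearMap.neg_apply, LinearMap.comp_apply]
  refine Submodule.neg_mem _ ?_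
  have h := congrArg (fun f : Matrix n n K →ₗ[K] Matrix n n K => f Y) (adInv_comp_adSubOne_comm t)
  simp only [LinearMap.comp_apply] at h
  rw [h]
  exact LinearMap.mem_range_self _ _

/-- `Ad_{t⁻¹} − 1` is INJECTIVE on the moving part `𝔪_K` (for `χ_t` separable): if `Y ∈ 𝔪_K` and `(Ad_{t⁻¹} − 1)Y = 0` then `(Ad_t − 1)Y = 0`, so `Y ∈ 𝔷(t) ∩ 𝔪_K = 0`.
[cite: HarishChandra1970, Lemma 22] -/
theorem eq_zero_of_adInvSubOne_eq_zero [PerfectField K] (t : GL n K) (hsep : (t : Matrix n n K).charpoly.Separable) {Y : Matrix n n K}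
    (hY : Y ∈ LinearMap.range (LinearMap.mulLeftRight K ((t : Matrix n n K), ((t⁻¹ : GL n K) : Matrix n n K)) - LinearMap.id : Matrix n n K →ₗ[K] Matrix n n K))
    (h0 : (LinearMap.mulLeftRight K (((t⁻¹ : GL n K) : Matrix n n K), (t : Matrix n n K)) - LinearMap.id : Matrix n n K →ₗ[K] Matrix n n K) Y = 0) : Y = 0 := by
  have hker : Y ∈ LinearMap.ker (LinearMap.mulLeftRight K ((t : Matrix n n K), ((t⁻¹ : GL n K) : Matrix n n K)) - LinearMap.id : Matrix n n K →ₗ[K] Matrix n n K) := by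
    rw [adInvSubOne_eq_neg_comp, LinearMap.neg_apply, LinearMap.comp_apply, neg_eq_zero, LinearMap.mulLeftRight_apply] at h0
    rw [LinearMap.mem_ker]
    have h := congrArg (fun Z => (t : Matrix n n K) * Z * ((t⁻¹ : GL n K) : Matrix n n K)) h0
    simpa only [Matrix.mul_assoc, Units.mul_inv, Matrix.mul_one, Matrix.mul_zero, Matrix.zero_mul, ← Matrix.mul_assoc (t : Matrix n n K) ((t⁻¹ : GL n K) : Matrix n n K),
      Matrix.one_mul] using h
  have h := (isCompl_ker_range_adSubOne t hsep).disjoint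
  rw [Submodule.disjoint_def] at h
  exact h Y hker hY

end AdK



end Summit.HodgeConjecture.HodgeConjecture.Cruxes.H413.F0P3cStCharTSCartanDecompositionAd

end
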